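import Literature.Computability.QuantumComplexity.ExactCompilerTowerCorrect
import Mathlib.Analysis.SpecialFunctions.Trigonometric.Inverse
import HarnessLib

/-!
# The exact braid compiler: the angle function, the rational certificates, one level of descent

Topic `Literature/Computability/QuantumComplexity`; sequel of `ExactCompilerTowerCorrect.lean`
(Aharonov–Arad 2011 §3.3: the gate compiler of the Jones-hardness reduction). Contents:

* `ang A = arccos(Re tr A / 2) ∈ [0, π]`, the rotation angle of `A ∈ SU(2)`:
  `A = R D(ang A) R⁻¹` (`exists_conj_torus_ang`), `Re tr(A^j) = 2cos(j · ang A)`, and the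
  chord/angle comparison `‖1 - A‖ ≤ ang A ≤ (π/2)‖1 - A‖`;
* soundness and completeness of the machine's certificates: `smallTest p q c ⇒ ang c ≤ p/q`
  (`cos x ≤ 1 - x²/2 + 5x⁴/96`, Mathlib `Real.cos_bound`), `ang c ≤ (p/q)/2 ⇒ smallTest`;
  `reachTest p q (c^J) ⇒ (π/2)(p/q) ≤ J · ang c` and `j · ang c ∈ [2(p/q), π] ⇒ reachTest`;
  whence `findJ` returns a `J ≤ Jmax` with `(π/2) e ≤ J · ang c` as soon as
  `2e / ang c + 1 ≤ Jmax` (`findJ_spec`);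
* **`norm_sub_levelStep_le`**: one level of the greedy descent divides the error by four —
  if `‖T - ev W‖ ≤ e = p/q`, some tower element is certified small at scale `e`, and `Jmax` is
  adequate, then `‖T - ev (levelStep … W)‖ ≤ e/4` (candidates net the ball:
  `SU2GreedyDescent.exists_conj_pow_near`; the exact score maximiser is the norm minimiser:
  `SU2ChordGeometry.norm_coe_sub_coe_sq`).

## References

* D. Aharonov, I. Arad, New J. Phys. 13 (2011) 035019, §3.3 [AharonovArad2011].
* C. M. Dawson, M. A. Nielsen, QIC 6 (2006), §3 [DawsonNielsen2006].
-/

noncomputable section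

open scoped Matrix.Norms.L2Operator

namespace Literature.Computability.QuantumComplexity

open Matrix Complex QuadraticAlgebra

local notation "SU2" => Matrix.specialUnitaryGroup (Fin 2) ℂ
local notation "M2" => Matrix (Fin 2) (Fin 2) ℂ

/-! ### The angle of an element of `SU(2)` -/

/-- **The rotation angle** `ang A = arccos(Re tr A / 2) ∈ [0, π]`. [folklore] -/
def ang (A : SU2) : ℝ := Real.arccos (((A : M2).trace).re / 2)

/-- `0 ≤ ang A`. [folklore] -/
theorem ang_nonneg (A : SU2) : 0 ≤ ang A := Real.arccos_nonneg _

/-- `ang A ≤ π`. [folklore] -/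
theorem ang_le_pi (A : SU2) : ang A ≤ Real.pi := Real.arccos_le_pi _

/-- **`A = R D(ang A) R⁻¹`.** [folklore] -/
theorem exists_conj_torus_ang (A : SU2) : ∃ R : SU2, A = R * torus (ang A) * R⁻¹ := by
  obtain ⟨R, ψ, h0, hπ, hA⟩ := exists_conj_torus A
  have htr : ((A : M2).trace).re = 2 * Real.cos ψ := by rw [hA, trace_conj, trace_torus_re]
  have hang : ang A = ψ := by rw [ang, htr, mul_div_cancel_left₀ _ two_ne_zero, Real.arccos_cos h0 hπ]
  exact ⟨R, by rw [hang]; exact hA⟩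

/-- `Re tr A = 2cos(ang A)`. [folklore] -/
theorem trace_re_eq_two_mul_cos_ang (A : SU2) : ((A : M2).trace).re = 2 * Real.cos (ang A) := by
  obtain ⟨R, hA⟩ := exists_conj_torus_ang A
  conv_lhs => rw [hA]
  rw [trace_conj, trace_torus_re]

/-- **`Re tr(A^j) = 2cos(j · ang A)`.** [folklore] -/
theorem trace_pow_re (A : SU2) (j : ℕ) : (((A ^ j : SU2) : M2).trace).re = 2 * Real.cos (j * ang A) := by
  obtain ⟨R, hA⟩ := exists_conj_torus_ang A
  conv_lhs => rw [hA, conj_pow, ← torus_nsmul]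
  rw [trace_conj, trace_torus_re]

/-- `‖1 - A‖² = 2 - 2cos(ang A)`. [folklore] -/
theorem norm_one_sub_sq_ang (A : SU2) : ‖(1 : M2) - (A : M2)‖ ^ 2 = 2 - 2 * Real.cos (ang A) := by
  rw [norm_one_sub_coe_sq, trace_re_eq_two_mul_cos_ang]

/-- **Chord ≤ angle.** [folklore] -/
theorem norm_one_sub_le_ang (A : SU2) : ‖(1 : M2) - (A : M2)‖ ≤ ang A := by
  obtain ⟨R, hA⟩ := exists_conj_torus_ang A
  have h := norm_one_sub_torus_le (ang A)
  rw [abs_of_nonneg (ang_nonneg A)] at h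
  conv_lhs => rw [hA]
  rwa [norm_one_sub_conj]

/-- **Angle ≤ (π/2) chord.** [folklore] -/
theorem ang_le_mul_norm_one_sub (A : SU2) : ang A ≤ Real.pi / 2 * ‖(1 : M2) - (A : M2)‖ := by
  obtain ⟨R, hA⟩ := exists_conj_torus_ang A
  have h := mul_abs_le_norm_one_sub_torus (ψ := ang A) (by rw [abs_of_nonneg (ang_nonneg A)]; exact ang_le_pi A)
  rw [abs_of_nonneg (ang_nonneg A)] at h
  have e : ‖(1 : M2) - ((torus (ang A) : SU2) : M2)‖ = ‖(1 : M2) - (A : M2)‖ := by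
    conv_rhs => rw [hA]
    rw [norm_one_sub_conj]
  rw [e] at h
  have hpi := Real.pi_pos
  calc ang A = Real.pi / 2 * (2 / Real.pi * ang A) := by field_simp
    _ ≤ Real.pi / 2 * ‖(1 : M2) - (A : M2)‖ := mul_le_mul_of_nonneg_left h (by positivity)

/-! ### The certificates -/

namespace ExactCompiler

variable {Γ : Type} (E : EvalSpec Γ)

/-- `toReal (zphis n) = n`. [folklore] -/
theorem toReal_zphis (n : ℤ) : ZPhiS.toReal (zphis n) = n := by
  rw [zphis, ZPhiS.toReal_apply]
  change ZPhi.toReal ⟨n, 0⟩ + ZPhi.toReal 0 * ZPhiS.sqrtTau = (n : ℝ)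
  rw [map_zero, zero_mul, add_zero, ZPhi.toReal_apply]
  simp

/-- `toReal (tr2 a) = 4cos(ang (ev a))`. [folklore] -/
theorem toReal_tr2_eq (a : Cand Γ) (ha : a.WF E.mat₀) : ZPhiS.toReal a.tr2 = 4 * Real.cos (ang (evS E a ha)) := by
  rw [toReal_tr2 E a ha, trace_re_eq_two_mul_cos_ang]; ring

/-- `cos x ≤ 1 - x²/2 + 5x⁴/96` for `|x| ≤ 1`. [folklore] -/
theorem cos_le_taylor {x : ℝ} (hx : |x| ≤ 1) : Real.cos x ≤ 1 - x ^ 2 / 2 + 5 * x ^ 4 / 96 := by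
  have h := Real.cos_bound hx
  rw [abs_le] at h
  have e : |x| ^ 4 = x ^ 4 := by rw [pow_abs, abs_of_nonneg (by positivity)]
  nlinarith [h.2, e]

/-- **Soundness of `smallTest`**: `smallTest p q c ⇒ ang (ev c) ≤ p/q` (for `0 < q`, `p ≤ q`). [folklore] -/
theorem ang_le_of_smallTest {p q : ℕ} (hq : 0 < q) (hpq : p ≤ q) {c : Cand Γ} (hc : c.WF E.mat₀)
    (h : smallTest p q c = true) : ang (evS E c hc) ≤ (p : ℝ) / q := by
  set θ := ang (evS E c hc) with hθ
  set x : ℝ := (p : ℝ) / q with hx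
  have hq' : (0 : ℝ) < q := by exact_mod_cast hq
  have hx0 : 0 ≤ x := by positivity
  have hx1 : x ≤ 1 := by rw [hx, div_le_one hq']; exact_mod_cast hpq
  -- the test in real terms: `24 q⁴ · 4cos θ ≥ 96 q⁴ - 48 p² q² + 5 p⁴`
  have ht : ¬ (ZPhiS.toReal (zphis (24 * (q : ℤ) ^ 4) * c.tr2) <
      ZPhiS.toReal (zphis (96 * (q : ℤ) ^ 4 - 48 * (p : ℤ) ^ 2 * (q : ℤ) ^ 2 + 5 * (p : ℤ) ^ 4))) := by
    intro hlt
    have := (ZPhiS.lt_iff _ _).2 hlt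
    rw [smallTest] at h
    simp [this] at h
  rw [map_mul, toReal_zphis, toReal_zphis, toReal_tr2_eq E c hc] at ht
  push_cast at ht
  rw [not_lt] at ht
  -- hence `cos θ ≥ 1 - x²/2 + 5x⁴/96 ≥ cos x`
  have hcos : Real.cos x ≤ Real.cos θ := by
    have h1 := cos_le_taylor (x := x) (by rw [abs_of_nonneg hx0]; exact hx1)
    have hq4 : (0 : ℝ) < (q : ℝ) ^ 4 := by positivity
    have key : (q : ℝ) ^ 4 * (96 * (1 - x ^ 2 / 2 + 5 * x ^ 4 / 96)) ≤ (q : ℝ) ^ 4 * (96 * Real.cos θ) := by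
      have e : (q : ℝ) ^ 4 * (96 * (1 - x ^ 2 / 2 + 5 * x ^ 4 / 96)) =
          96 * (q : ℝ) ^ 4 - 48 * (p : ℝ) ^ 2 * (q : ℝ) ^ 2 + 5 * (p : ℝ) ^ 4 := by
        rw [hx]; field_simp; ring
      rw [e]; linarith
    have := le_of_mul_le_mul_left key hq4
    linarith
  -- `cos` is strictly antitone on `[0, π]`
  by_contra hlt
  push Not at hlt
  have hθπ : θ ≤ Real.pi := ang_le_pi _
  have : Real.cos θ < Real.cos x :=
    Real.cos_lt_cos_of_nonneg_of_le_pi hx0 hθπ hlt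
  linarith

/-- `smallTest` unfolded: it holds iff `¬ (24 q⁴ · toReal tr2 < toReal rhs)`. [folklore] -/
theorem smallTest_eq_true_iff (p q : ℕ) (c : Cand Γ) :
    smallTest p q c = true ↔ ¬ (ZPhiS.toReal (zphis (24 * (q : ℤ) ^ 4) * c.tr2) <
      ZPhiS.toReal (zphis (96 * (q : ℤ) ^ 4 - 48 * (p : ℤ) ^ 2 * (q : ℤ) ^ 2 + 5 * (p : ℤ) ^ 4))) := by
  rw [smallTest, Bool.not_eq_true', ← ZPhiS.lt_iff, Bool.eq_false_iff]

/-- `reachTest` unfolded. [folklore] -/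
theorem reachTest_eq_true_iff (p q : ℕ) (a : Cand Γ) :
    reachTest p q a = true ↔ ¬ (ZPhiS.toReal (zphis (4 * (q : ℤ) ^ 2 - 5 * (p : ℤ) ^ 2)) <
      ZPhiS.toReal (zphis ((q : ℤ) ^ 2) * a.tr2)) := by
  rw [reachTest, Bool.not_eq_true', ← ZPhiS.lt_iff, Bool.eq_false_iff]

/-- **Completeness of `smallTest`**: `ang (ev c) ≤ (p/q)/2 ⇒ smallTest p q c` (for `0 < q`, `p ≤ q`).
[folklore] -/
theorem smallTest_of_ang_le {p q : ℕ} (hq : 0 < q) (hpq : p ≤ q) {c : Cand Γ} (hc : c.WF E.mat₀)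
    (h : ang (evS E c hc) ≤ (p : ℝ) / q / 2) : smallTest p q c = true := by
  set θ := ang (evS E c hc) with hθ
  set x : ℝ := (p : ℝ) / q with hx
  have hq' : (0 : ℝ) < q := by exact_mod_cast hq
  have hx0 : 0 ≤ x := by positivity
  have hx1 : x ≤ 1 := by rw [hx, div_le_one hq']; exact_mod_cast hpq
  have hθ0 : 0 ≤ θ := ang_nonneg _
  have hcos : 1 - x ^ 2 / 2 + 5 * x ^ 4 / 96 ≤ Real.cos θ := by
    have h1 : Real.cos (x / 2) ≤ Real.cos θ :=
      Real.cos_le_cos_of_nonneg_of_le_pi hθ0 (by linarith [Real.pi_gt_three]) h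
    have h2 := Real.one_sub_sq_div_two_le_cos (x := x / 2)
    have hx2 : x ^ 2 ≤ 1 := by nlinarith
    have h3 : 5 * x ^ 4 / 96 ≤ 3 * x ^ 2 / 8 := by nlinarith [sq_nonneg x]
    nlinarith
  rw [smallTest_eq_true_iff, map_mul, toReal_zphis, toReal_zphis, toReal_tr2_eq E c hc, not_lt]
  push_cast
  have e : (q : ℝ) ^ 4 * (96 * (1 - x ^ 2 / 2 + 5 * x ^ 4 / 96)) =
      96 * (q : ℝ) ^ 4 - 48 * (p : ℝ) ^ 2 * (q : ℝ) ^ 2 + 5 * (p : ℝ) ^ 4 := by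
    rw [hx]; field_simp; ring
  have hq4 : (0 : ℝ) ≤ (q : ℝ) ^ 4 := by positivity
  have := mul_le_mul_of_nonneg_left (mul_le_mul_of_nonneg_left hcos (by norm_num : (0 : ℝ) ≤ 96)) hq4
  rw [e] at this
  linarith

/-- **Soundness of `reachTest`**: `reachTest p q (c^J) ⇒ (π/2)(p/q) ≤ J · ang (ev c)` (for `p/q ≤ 2`).
[folklore] -/
theorem le_mul_ang_of_reachTest {p q : ℕ} (hq : 0 < q) (hpq : p ≤ 2 * q) {c : Cand Γ} (hc : c.WF E.mat₀) {J : ℕ}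
    (h : reachTest p q (c.pow J) = true) : Real.pi / 2 * ((p : ℝ) / q) ≤ J * ang (evS E c hc) := by
  set θ := ang (evS E c hc) with hθ
  set e : ℝ := (p : ℝ) / q with he
  have hq' : (0 : ℝ) < q := by exact_mod_cast hq
  have he0 : 0 ≤ e := by positivity
  have he2 : e ≤ 2 := by rw [he, div_le_iff₀ hq']; exact_mod_cast hpq
  -- the test in real terms: `4 q² cos(Jθ) ≤ 4 q² - 5 p²`
  rw [reachTest_eq_true_iff, map_mul, toReal_zphis, toReal_zphis, toReal_tr2_eq E _ (hc.pow J), not_lt] at h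
  have hJ' : ((evS E (c.pow J) (hc.pow J) : SU2) : M2) = ((evS E c hc ^ J : SU2) : M2) := by rw [evS_pow]
  have hcosJ : Real.cos (ang (evS E (c.pow J) (hc.pow J))) = Real.cos (J * θ) := by
    have a := trace_re_eq_two_mul_cos_ang (evS E (c.pow J) (hc.pow J))
    have b := trace_pow_re (evS E c hc) J
    rw [hJ'] at a
    linarith
  rw [hcosJ] at h
  push_cast at h
  have hcos : Real.cos (J * θ) ≤ 1 - 5 / 4 * e ^ 2 := by
    have hq2 : (0 : ℝ) < (q : ℝ) ^ 2 := by positivity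
    have key : (q : ℝ) ^ 2 * (4 * Real.cos (J * θ)) ≤ (q : ℝ) ^ 2 * (4 * (1 - 5 / 4 * e ^ 2)) := by
      have ee : (q : ℝ) ^ 2 * (4 * (1 - 5 / 4 * e ^ 2)) = 4 * (q : ℝ) ^ 2 - 5 * (p : ℝ) ^ 2 := by rw [he]; field_simp
      rw [ee]; linarith
    have := le_of_mul_le_mul_left key hq2
    linarith
  -- if `Jθ < (π/2) e ≤ π` then `cos(Jθ) > cos((π/2)e) ≥ 1 - (π²/8) e² > 1 - (5/4) e²`
  by_contra hlt
  push Not at hlt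
  have hJθ0 : 0 ≤ (J : ℝ) * θ := mul_nonneg (Nat.cast_nonneg _) (ang_nonneg _)
  have hpi := Real.pi_pos
  have hye : Real.pi / 2 * e ≤ Real.pi := by nlinarith
  have h1 : Real.cos (Real.pi / 2 * e) < Real.cos (J * θ) := Real.cos_lt_cos_of_nonneg_of_le_pi hJθ0 hye hlt
  have h2 := Real.one_sub_sq_div_two_le_cos (x := Real.pi / 2 * e)
  have hπ2 : (Real.pi / 2) ^ 2 / 2 < 5 / 4 := by
    have := Real.pi_lt_d2; nlinarith
  have h3 : 1 - 5 / 4 * e ^ 2 ≤ 1 - (Real.pi / 2 * e) ^ 2 / 2 := by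
    rw [mul_pow]; nlinarith [sq_nonneg e]
  linarith

/-- **Completeness of `reachTest`**: if `j · ang(ev c) ∈ [2(p/q), π]` then `reachTest p q (c^j)` (for
`p/q ≤ 1/2`). [folklore] -/
theorem reachTest_of_mul_ang_mem {p q : ℕ} (hq : 0 < q) (hpq : 2 * p ≤ q) {c : Cand Γ} (hc : c.WF E.mat₀) {j : ℕ}
    (h1 : 2 * ((p : ℝ) / q) ≤ j * ang (evS E c hc)) (h2 : j * ang (evS E c hc) ≤ Real.pi) :
    reachTest p q (c.pow j) = true := by
  set θ := ang (evS E c hc) with hθ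
  set e : ℝ := (p : ℝ) / q with he
  have hq' : (0 : ℝ) < q := by exact_mod_cast hq
  have he0 : 0 ≤ e := by positivity
  have he1 : e ≤ 1 / 2 := by
    rw [he, div_le_iff₀ hq']; have : (2 * p : ℝ) ≤ q := by exact_mod_cast hpq
    linarith
  have hj' : ((evS E (c.pow j) (hc.pow j) : SU2) : M2) = ((evS E c hc ^ j : SU2) : M2) := by rw [evS_pow]
  have hcosJ : Real.cos (ang (evS E (c.pow j) (hc.pow j))) = Real.cos (j * θ) := by
    have a := trace_re_eq_two_mul_cos_ang (evS E (c.pow j) (hc.pow j))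
    have b := trace_pow_re (evS E c hc) j
    rw [hj'] at a
    linarith
  -- `cos(jθ) ≤ cos(2e) ≤ 1 - 2e² + (5/6) e⁴ ≤ 1 - (5/4) e²`
  have hc1 : Real.cos (j * θ) ≤ Real.cos (2 * e) :=
    Real.cos_le_cos_of_nonneg_of_le_pi (by positivity) h2 h1
  have hc2 := cos_le_taylor (x := 2 * e) (by rw [abs_of_nonneg (by positivity)]; linarith)
  have hc3 : Real.cos (j * θ) ≤ 1 - 5 / 4 * e ^ 2 := by
    have : e ^ 2 ≤ 1 / 4 := by nlinarith
    nlinarith [sq_nonneg e]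
  rw [reachTest_eq_true_iff, map_mul, toReal_zphis, toReal_zphis, toReal_tr2_eq E _ (hc.pow j), hcosJ, not_lt]
  push_cast
  have ee : (4 : ℝ) * (q : ℝ) ^ 2 - 5 * (p : ℝ) ^ 2 = (q : ℝ) ^ 2 * (4 * (1 - 5 / 4 * e ^ 2)) := by rw [he]; field_simp
  rw [ee]
  have hq2 : (0 : ℝ) ≤ (q : ℝ) ^ 2 := by positivity
  nlinarith

/-- **`findJ` finds a certified number of powers**: if `2e/ang(ev c) + 1 ≤ Jmax`, `0 < ang(ev c) ≤ π/2`
and `e = p/q ≤ 1/2`, then `J = findJ p q Jmax c` satisfies `reachTest p q (c^J)` and `J ≤ Jmax`.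
[folklore] -/
theorem findJ_spec {p q Jmax : ℕ} (hq : 0 < q) (hpq : 2 * p ≤ q) {c : Cand Γ} (hc : c.WF E.mat₀)
    (hθ0 : 0 < ang (evS E c hc)) (hθ : ang (evS E c hc) ≤ Real.pi / 2)
    (hJmax : 2 * ((p : ℝ) / q) / ang (evS E c hc) + 1 ≤ Jmax) :
    reachTest p q (c.pow (findJ p q Jmax c)) = true ∧ findJ p q Jmax c ≤ Jmax := by
  set θ := ang (evS E c hc) with hθdef
  set e : ℝ := (p : ℝ) / q with he
  have hq' : (0 : ℝ) < q := by exact_mod_cast hq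
  have he0 : 0 ≤ e := by positivity
  have he1 : e ≤ 1 / 2 := by
    rw [he, div_le_iff₀ hq']; have : (2 * p : ℝ) ≤ q := by exact_mod_cast hpq
    linarith
  -- the witness `j₀ = ⌈2e/θ⌉` (at least `1`)
  set j₀ : ℕ := max 1 ⌈2 * e / θ⌉₊ with hj₀
  have hj₀1 : 1 ≤ j₀ := le_max_left _ _
  have hj₀J : j₀ ≤ Jmax := by
    have h1 : (⌈2 * e / θ⌉₊ : ℝ) < 2 * e / θ + 1 := Nat.ceil_lt_add_one (by positivity)
    have h2 : (⌈2 * e / θ⌉₊ : ℝ) ≤ Jmax := by linarith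
    have h3 : ⌈2 * e / θ⌉₊ ≤ Jmax := by exact_mod_cast h2
    have h4 : 1 ≤ Jmax := by
      have : (1 : ℝ) ≤ Jmax := le_trans (by linarith [div_nonneg (by positivity : (0:ℝ) ≤ 2 * e) hθ0.le]) hJmax
      exact_mod_cast this
    exact max_le h4 h3
  have hpass : reachTest p q (c.pow j₀) = true := by
    apply reachTest_of_mul_ang_mem E hq hpq hc
    · -- `2e ≤ j₀ θ`
      have h1 : 2 * e / θ ≤ ⌈2 * e / θ⌉₊ := Nat.le_ceil _
      have h2 : (⌈2 * e / θ⌉₊ : ℝ) ≤ j₀ := by exact_mod_cast le_max_right _ _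
      calc 2 * e = 2 * e / θ * θ := by field_simp
        _ ≤ j₀ * θ := mul_le_mul_of_nonneg_right (h1.trans h2) hθ0.le
    · -- `j₀ θ ≤ 2e + θ ≤ π`
      rcases le_or_gt ⌈2 * e / θ⌉₊ 1 with hle | hgt
      · have : j₀ = 1 := by rw [hj₀]; omega
        rw [this]; push_cast; linarith
      · have : j₀ = ⌈2 * e / θ⌉₊ := by rw [hj₀]; omega
        rw [this]
        have h1 : (⌈2 * e / θ⌉₊ : ℝ) < 2 * e / θ + 1 := Nat.ceil_lt_add_one (by positivity)
        have h2 : (⌈2 * e / θ⌉₊ : ℝ) * θ ≤ (2 * e / θ + 1) * θ := mul_le_mul_of_nonneg_right h1.le hθ0.le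
        rw [add_mul, div_mul_cancel₀ _ hθ0.ne', one_mul] at h2
        linarith [Real.pi_gt_three]
  -- `findJ` returns the first passing index of `[1, …, Jmax]`, hence a passing one
  unfold findJ
  set L := (List.range Jmax).map (· + 1) with hL
  have hmemL : ∀ j, j ∈ L ↔ 1 ≤ j ∧ j ≤ Jmax := by
    intro j; rw [hL, List.mem_map]; constructor
    · rintro ⟨a, ha, rfl⟩; rw [List.mem_range] at ha; omega
    · rintro ⟨h1, h2⟩; exact ⟨j - 1, by rw [List.mem_range]; omega, by omega⟩
  cases hf : L.find? (fun j => reachTest p q (c.pow j)) with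
  | none =>
    exfalso
    have := List.find?_eq_none.1 hf j₀ ((hmemL j₀).2 ⟨hj₀1, hj₀J⟩)
    exact this hpass
  | some J =>
    simp only [Option.getD_some]
    exact ⟨List.find?_some (p := fun j => reachTest p q (c.pow j)) hf, ((hmemL J).1 (List.mem_of_find?_eq_some hf)).2⟩

/-! ### One level of the descent -/

/-- Members of `levelCands` are well formed. [folklore] -/
theorem wf_of_mem_levelCands {net : List (Cand Γ)} (hnet : AllWF E net) {c : Cand Γ} (hc : c.WF E.mat₀) {J : ℕ}
    {Y : Cand Γ} (hY : Y ∈ levelCands net c J) : Y.WF E.mat₀ := by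
  unfold levelCands at hY
  obtain ⟨V, hV, hY⟩ := List.mem_flatMap.1 hY
  obtain ⟨j, _, hY⟩ := List.mem_flatMap.1 hY
  simp only [List.mem_cons, List.mem_nil_iff, or_false] at hY
  rcases hY with rfl | rfl
  · exact (hnet V hV).conj (hc.pow j)
  · exact (hnet V hV).conj (hc.inv.pow j)

/-- `V c^j V⁻¹` is a candidate. [folklore] -/
theorem conj_pow_mem_levelCands {net : List (Cand Γ)} {V c : Cand Γ} (hV : V ∈ net) {j J : ℕ} (hj : j ≤ J) :
    V.conj (c.pow j) ∈ levelCands net c J := by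
  unfold levelCands
  refine List.mem_flatMap.2 ⟨V, hV, List.mem_flatMap.2 ⟨j, List.mem_range.2 (by omega), by simp⟩⟩

/-- **The exact score maximiser is the norm minimiser.** If `κ · toReal(score A) = Re tr(T† · ev A)`
for a `κ > 0`, then comparing scores compares distances to `T`. [folklore] -/
theorem norm_sub_le_of_score_le {T : SU2} {score : Matrix (Fin 2) (Fin 2) K5 → ZPhiS} {κ : ℝ} (hκ : 0 < κ)
    (hscore : ∀ (a : Cand Γ) (ha : a.WF E.mat₀), κ * ZPhiS.toReal (score a.mat) =
      ((star (T : M2) * ((evS E a ha : SU2) : M2)).trace).re)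
    {a b : Cand Γ} (ha : a.WF E.mat₀) (hb : b.WF E.mat₀) (h : ZPhiS.toReal (score b.mat) ≤ ZPhiS.toReal (score a.mat)) :
    ‖(T : M2) - ((evS E a ha : SU2) : M2)‖ ≤ ‖(T : M2) - ((evS E b hb : SU2) : M2)‖ := by
  have e1 := norm_coe_sub_coe_sq T (evS E a ha)
  have e2 := norm_coe_sub_coe_sq T (evS E b hb)
  have h1 := hscore a ha
  have h2 := hscore b hb
  have hsq : ‖(T : M2) - ((evS E a ha : SU2) : M2)‖ ^ 2 ≤ ‖(T : M2) - ((evS E b hb : SU2) : M2)‖ ^ 2 := by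
    rw [e1, e2]; nlinarith
  exact (pow_le_pow_iff_left₀ (norm_nonneg _) (norm_nonneg _) two_ne_zero).1 hsq

/-- The default tower element is well formed. [folklore] -/
theorem wf_getLastD {L : List (Cand Γ)} (hL : AllWF E L) {d : Cand Γ} (hd : d.WF E.mat₀) : (L.getLastD d).WF E.mat₀ := by
  induction L generalizing d with
  | nil => simpa using hd
  | cons x t ih =>
    rw [List.getLastD_cons]
    exact ih (fun a ha => hL a (List.mem_cons_of_mem _ ha)) (hL x (by simp))

/-- The selected tower element is well formed. [folklore] -/
theorem wf_selected {towerL : List (Cand Γ)} (htower : AllWF E towerL) (p q : ℕ) :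
    ((towerL.find? (smallTest p (16 * q))).getD (towerL.getLastD Cand.one)).WF E.mat₀ := by
  cases hf : towerL.find? (smallTest p (16 * q)) with
  | some c' => simpa using htower c' (List.mem_of_find?_eq_some hf)
  | none => simpa using wf_getLastD E htower Cand.WF.one

/-- `levelStep`, unfolded. [folklore] -/
theorem levelStep_eq (net towerL : List (Cand Γ)) (score : Matrix (Fin 2) (Fin 2) K5 → ZPhiS) (p q Jmax : ℕ) (W : Cand Γ) :
    levelStep net towerL score p q Jmax W =
      (bestBy (fun a b => ZPhiS.lt b a) (fun X => score (X.mat * W.mat))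
        ((levelCands net ((towerL.find? (smallTest p (16 * q))).getD (towerL.getLastD Cand.one))
          (findJ p q Jmax ((towerL.find? (smallTest p (16 * q))).getD (towerL.getLastD Cand.one)))).headD Cand.one)
        (levelCands net ((towerL.find? (smallTest p (16 * q))).getD (towerL.getLastD Cand.one))
          (findJ p q Jmax ((towerL.find? (smallTest p (16 * q))).getD (towerL.getLastD Cand.one))))).mul W := rfl

/-- The maximiser over a list of well-formed candidates is well formed. [folklore] -/
theorem wf_bestBy_max {cands : List (Cand Γ)} (hall : ∀ Y ∈ cands, Y.WF E.mat₀) (key : Cand Γ → ZPhiS) :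
    (bestBy (fun a b => ZPhiS.lt b a) key (cands.headD Cand.one) cands).WF E.mat₀ := by
  have hd : (cands.headD Cand.one).WF E.mat₀ := by
    cases h : cands with
    | nil => simpa using Cand.WF.one
    | cons x t => simpa using hall x (by rw [h]; simp)
  rcases bestBy_mem (fun a b => ZPhiS.lt b a) key (cands.headD Cand.one) cands with h | h
  · rw [h]; exact hd
  · exact hall _ h

/-- `levelStep` is well formed. [folklore] -/
theorem wf_levelStep {net : List (Cand Γ)} (hnet : AllWF E net) {towerL : List (Cand Γ)} (htower : AllWF E towerL)
    (score : Matrix (Fin 2) (Fin 2) K5 → ZPhiS) (p q Jmax : ℕ) {W : Cand Γ} (hW : W.WF E.mat₀) :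
    (levelStep net towerL score p q Jmax W).WF E.mat₀ := by
  rw [levelStep_eq]
  exact (wf_bestBy_max E (fun Y hY => wf_of_mem_levelCands E hnet (wf_selected E htower p q) hY) _).mul hW

/-- **One level of the descent divides the error by four.** Let `net` be a `1/200`-net,
`towerL` a list of well-formed candidates with angles in `(0, π/2]`, `score` an exact positive
multiple of `Re tr(T† ·)`, `e = p/q ≤ 1/2`; suppose some element of `towerL` passes `smallTest` at
scale `e/16`, and `2e/ang + 1 ≤ Jmax` for every element of `towerL`. If `‖T - ev W‖ ≤ e` then
`‖T - ev (levelStep … W)‖ ≤ e/4`. [cite: AharonovArad2011, §3.3] -/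
theorem norm_sub_levelStep_le {net : List (Cand Γ)} (hnet : IsNet E net)
    {towerL : List (Cand Γ)} (htower : AllWF E towerL)
    (hang : ∀ c ∈ towerL, ∀ hc : c.WF E.mat₀, 0 < ang (evS E c hc) ∧ ang (evS E c hc) ≤ Real.pi / 2)
    (T : SU2) {score : Matrix (Fin 2) (Fin 2) K5 → ZPhiS} {κ : ℝ} (hκ : 0 < κ)
    (hscore : ∀ (a : Cand Γ) (ha : a.WF E.mat₀), κ * ZPhiS.toReal (score a.mat) =
      ((star (T : M2) * ((evS E a ha : SU2) : M2)).trace).re)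
    {p q Jmax : ℕ} (hq : 0 < q) (hpq : 2 * p ≤ q)
    (hsmall : ∃ c ∈ towerL, smallTest p (16 * q) c = true)
    (hJmax : ∀ c ∈ towerL, ∀ hc : c.WF E.mat₀, 2 * ((p : ℝ) / q) / ang (evS E c hc) + 1 ≤ Jmax)
    {W : Cand Γ} (hW : W.WF E.mat₀) (hTW : ‖(T : M2) - ((evS E W hW : SU2) : M2)‖ ≤ (p : ℝ) / q) :
    ‖(T : M2) - ((evS E (levelStep net towerL score p q Jmax W)
      (wf_levelStep E hnet.1 htower score p q Jmax hW) : SU2) : M2)‖ ≤ (p : ℝ) / q / 4 := by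
  set e : ℝ := (p : ℝ) / q with he
  have hq' : (0 : ℝ) < q := by exact_mod_cast hq
  -- the selected tower element
  obtain ⟨c₁, hc₁, hc₁t⟩ := hsmall
  have hfind : ∃ c, towerL.find? (smallTest p (16 * q)) = some c := by
    cases hf : towerL.find? (smallTest p (16 * q)) with
    | some c => exact ⟨c, rfl⟩
    | none => exact absurd hc₁t (by have := List.find?_eq_none.1 hf c₁ hc₁; simpa using this)
  obtain ⟨c, hcf⟩ := hfind
  have hcmem : c ∈ towerL := List.mem_of_find?_eq_some hcf
  have hctest : smallTest p (16 * q) c = true := List.find?_some hcf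
  have hc : c.WF E.mat₀ := htower c hcmem
  obtain ⟨hθ0, hθπ2⟩ := hang c hcmem hc
  -- its angle is at most `e/16`
  have hθe : ang (evS E c hc) ≤ e / 16 := by
    have h16 : 0 < 16 * q := by omega
    have := ang_le_of_smallTest E h16 (by omega) hc hctest
    rw [he]; push_cast at this
    calc ang (evS E c hc) ≤ (p : ℝ) / (16 * q) := this
      _ = (p : ℝ) / q / 16 := by field_simp
  -- the number of powers
  obtain ⟨hJtest, _⟩ := findJ_spec E hq hpq hc hθ0 hθπ2 (hJmax c hcmem hc)
  set J := findJ p q Jmax c with hJdef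
  have hJ : Real.pi / 2 * e ≤ J * ang (evS E c hc) := le_mul_ang_of_reachTest E hq (by omega) hc hJtest
  -- unfold the level
  have hlevel : levelStep net towerL score p q Jmax W =
      (bestBy (fun a b => ZPhiS.lt b a) (fun X => score (X.mat * W.mat)) ((levelCands net c J).headD Cand.one)
        (levelCands net c J)).mul W := by
    rw [levelStep_eq, hcf]; rfl
  set cands := levelCands net c J with hcands
  set X := bestBy (fun a b => ZPhiS.lt b a) (fun X => score (X.mat * W.mat)) (cands.headD Cand.one) cands with hXdef
  have hall : ∀ Y ∈ cands, Y.WF E.mat₀ := fun Y hY => wf_of_mem_levelCands E hnet.1 hc hY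
  have hX : X.WF E.mat₀ := wf_bestBy_max E hall _
  have hres : evS E (levelStep net towerL score p q Jmax W) (wf_levelStep E hnet.1 htower score p q Jmax hW) =
      evS E X hX * evS E W hW := by
    rw [← evS_mul]; exact Subtype.ext (by simp only [coe_evS]; rw [hlevel])
  rw [hres]
  -- the evaluated net is a `1/20`-net
  have hNetS : ∀ B : SU2, ∃ V ∈ (net.attach.map fun V => evS E V.1 (hnet.1 V.1 V.2)), ‖(B : M2) - (V : M2)‖ ≤ 1 / 20 := by
    intro B
    obtain ⟨V, hV, hW', hVB⟩ := hnet.2 B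
    exact ⟨evS E V hW', List.mem_map.2 ⟨⟨V, hV⟩, List.mem_attach _ _, rfl⟩, hVB.trans (by norm_num)⟩
  -- the greedy step
  obtain ⟨R₀, hcR⟩ := exists_conj_torus_ang (evS E c hc)
  refine norm_sub_le_of_greedy (C := (cands.attach.map fun Y => evS E Y.1 (hall Y.1 Y.2))) (e := e) (e' := e / 4)
    hTW (fun A hA => ?_) (fun Z hZ => ?_)
  · -- candidates net the ball
    have hnear' := exists_conj_pow_near hNetS hcR hθ0 hθe hJ A hA
    obtain ⟨V, hV, j, hj, hnear⟩ := hnear'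
    obtain ⟨⟨V', hV'⟩, -, rfl⟩ := List.mem_map.1 hV
    have hmem : V'.conj (c.pow j) ∈ cands := conj_pow_mem_levelCands hV' hj
    refine ⟨_, List.mem_map.2 ⟨⟨_, hmem⟩, List.mem_attach _ _, rfl⟩, ?_⟩
    have e1 : evS E (V'.conj (c.pow j)) (hall _ hmem) = evS E V' (hnet.1 V' hV') * evS E c hc ^ j * (evS E V' (hnet.1 V' hV'))⁻¹ := by
      have : evS E (V'.conj (c.pow j)) (hall _ hmem) = evS E (V'.conj (c.pow j)) ((hnet.1 V' hV').conj (hc.pow j)) := rfl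
      rw [this, evS_conj E V' (c.pow j) (hnet.1 V' hV') (hc.pow j), evS_pow E c hc j]
    rw [e1]; exact hnear
  · -- optimality of the exact maximiser
    obtain ⟨⟨Y, hY⟩, -, rfl⟩ := List.mem_map.1 hZ
    have hkey := (le_toReal_key_bestBy (fun X => score (X.mat * W.mat)) (cands.headD Cand.one) cands).2 Y hY
    rw [← hXdef] at hkey
    have := norm_sub_le_of_score_le E hκ hscore (hX.mul hW) ((hall Y hY).mul hW) hkey
    rw [evS_mul, evS_mul] at this
    exact this

end ExactCompiler

end Literature.Computability.QuantumComplexity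

end
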